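import Literature.AnabelianGeometry.EtaleTheta.Discharge.Sec5JunctionSmallIndexHypotheses
import Literature.AnabelianGeometry.EtaleTheta.Discharge.Sec4LevelSaturationThetaTwistTower
import HarnessLib

/-!
# [EtTh] Prop. 4.2 (iii) AS TYPED — POSITIVE at the SMALL-INDEX fourth tower model (`K : Type 0`): coprime pull-backs, the E2 root law,
# LEVEL-WISE `μ_K`-saturation and the refinement law at `temperedFrobenioidSmall`, and the knit at `settingSmall` / `settingSmallYdd`
# (Def. 4.1 pp.312–313, Prop. 4.2 (iii) pp.314–316 / PDF pp.86–90)

S. Mochizuki, *The étale theta function …*, Publ. RIMS **45** (2009) [MochizukiEtTh2009], Def. 4.1 (i)(ii)(iv) pp.312–313 (PDF pp.86–87), Prop. 4.2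
(iii) pp.314–316 (proof p.315 l.77 – p.316 l.25; PDF pp.88–90) [cite: MochizukiEtTh2009, Prop 4.2 (iii) p.314 (PDF p.88)]; [FrdI] Thm. 5.2 (i)(ii)
p.100–101, Prop. 4.1 (iii) p.74; [FrdII] Def. 2.1 (i) p.16, Rmk. 2.2.1 p.18; [SemiAnbd] Rmk. 3.1.3 p.34.
PAGE CONVENTION for [EtTh]: «printed N (PDF p.M)», N = M + 226.

abc-iut cell, layer L2, seat abc-iut-L2-t3 (gen 10; [EtTh] §3/§4 lineage, `temperedFrobenioidSmall` / `settingSmall` owner p501267), row «P42III@SMALL-INDEX»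
(abc-iut-L2-lead gen 9; the port asked for in abc-iut-L2-d2's D3 note 07:37:11Z «roots at `temperedFrobenioidSmall` displayed unless someone ports
abc-iut-w6-d037's chain by `repr`»).  PROOF-ONLY; ADDITIVE; nothing landed is edited or restated.  Consumed BY NAME: abc-iut-w6-d037's
`PowDiagonalBase.coprimePullLaw_of_perfection` (p496921), `exists_galoisCover_level_charTrivial` and the law-level closer
`Prop42Sub.prop42_iii_mkOfModelCanonical_of_laws` (p499861 / abc-iut-w4-d044), `isMuSaturated_of_bZero_generator` (p496075); abc-iut-L2-d2's
MU-TORSION (M3) `exists_units_generator_of_fixed` (p500836) and character adapter `actFn_zetaImage_eq_of_right_eq_one` / `orderOf_zetaImage`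
(p501418), FILE 4's `Φ₀_map_disjoint` (p496921 §2); abc-iut-L2-t3's `temperedFrobenioidSmall` / `repr` / `reprIso` / `lvlC_repr` /
`baseRootLaw_galois_temperedFrobenioidSmall` (p501267), `isDivisorial_small` / `settingSmallYdd` (p504077), sockets `mkOfQuotientTemperoid` /
`mkOfQuotientTemperoid_galoisSurj_natural` (p496572).  THE POINT: every lemma of the FILE-4 chain is about the `Compat₃′`-set `gset Y` of a
covering; the small-index model reads the covering `A` at its coset re-presentation `repr A ≅ A`, whose `gset` IS a `Compat₃′`-set — so the
chain applies BY NAME at `repr A`, the only transport being that of point-stabilisers along `reprIso`.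
* §1 `coprimePullLaw_small` (hDSpull), `rootLaw_galois_small` (hR from A10 p501267);
* §2 **`levelSaturation_small`** — the level-wise law `hsat` at the small index: `K ∣ N_m`, `m ≤ lvl(A^bs)`, `χ_m(Stab) = 1` ⇒ `IsMuSaturated A K`;
* §3 `refinementLaw_small` (hE at the trivial `(N,H)`-slot) and the KNIT **`prop42_iii_mkOfQuotientTemperoid_small`** — [EtTh] Prop. 4.2 (iii) AS
  TYPED for the §4 setting `mkOfQuotientTemperoid X isTempered_compat₃′ φ hφ (temperedFrobenioidSmall R S) …` at `K : Type 0`, every Frobenius-trivial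
  Galois-based anchor, the ONLY displayed input being the (design-only) onto `φ`; instances **`prop42_iii_settingSmall`**, **`prop42_iii_settingSmallYdd`**
  — so D5's ROOTS are THEOREMS at the junction carrier of record (abc-iut-L2-d2's fraction pairs acquire `N`-th roots for every `N ≥ 1`).
HONEST FRAMING: class-(b) combinatorial design carrier (NOT the tempered Frobenioid of a Tate curve); the onto-socket is design-only (finding of record
R1257; the true-shape carrier is `settingClosureRange`, whose Prop. 4.2 (iii) is the sequel «P42III@CLOSURE-RANGE» modulo (LEV)); trivial
`(N,H)`-slot; nothing here bears on, or takes a side on, the disputed [IUTchIII] Cor. 3.12; nothing here asserts abc proved or refuted; typed ≠ proved.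
-/

noncomputable section

namespace Literature.AnabelianGeometry.EtaleTheta

open CategoryTheory Opposite Function Literature.AlgebraicGeometry.Frobenioids Literature.AnabelianGeometry.SemiGraphs
  Literature.AnabelianGeometry.SemiGraphs.GaloisObjects Literature.AlgebraicGeometry.Frobenioids.QuasiTemperoid
  LogDivisorModel LogDivisorModel.GaloisAction LogDivisorTower TateTowerKummerTwistRShear LogDivisorModel.TateTowerThetaTwist

namespace ThetaTwistTowerSmallIndex

open ThetaTwistTowerTempered
open TateTowerKummerTwist (M N N_dvd_M N_dvd_N)

variable (R S : ((ConnectedPart (BTemp (Compat 3 thetaShear)))ᵒᵖ ⥤ CommMonCat.{0}) → Prop)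

/-! ## §1 Coprime pull-backs (hDSpull) and the root law in binder shape (hR) at the small index -/

/-- **The coprimality-pull-back law `hDSpull` ([FrdI] Prop. 4.1 (iii)) HOLDS at the small-index fourth model**: disjoint supports pull back to
disjoint supports along `repr B → repr A` (FILE 4's `Φ₀_map_disjoint`) and the law transfers from the perfections (abc-iut-w6-d037's engine lemma).
[cite: MochizukiEtTh2009, Def 4.1 (i) p.312 (PDF p.86)] -/
theorem coprimePullLaw_small : (temperedFrobenioidSmall R S).CoprimePullLaw :=
  TemperedFrobenioid.PowDiagonalBase.coprimePullLaw_of_perfection hpfSmall powDiagonalBaseSmall _ _ _ R S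
    fun f α β hαβ η hηα hηβ =>
      TateTowerTheta.perfection_map_coprime φ₃ _ _ (fun a b h => Φ₀_map_disjoint (toConn.map (equivConn.inverse.map f)) a b h)
        α β hαβ η hηα hηβ

/-- **The E2 root law `hR` in the `B`-side binder shape, `IG := «A Galois»`, at the small index — NO hypothesis** (A10
`baseRootLaw_galois_temperedFrobenioidSmall`, `Φ` perfect, `hTF` at the weak vocabulary). [cite: MochizukiEtTh2009, Prop 4.2 (iii) p.315 (PDF p.89)] -/
theorem rootLaw_galois_small (N : ℕ+) (A : ConnectedPart (BTemp (Compat 3 thetaShear))) (hA : IsGaloisObj A.obj)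
    (f : (temperedFrobenioidSmall R S).ratFnFunctor.obj (op A)) :
    ∃ (A' : ConnectedPart (BTemp (Compat 3 thetaShear))) (_ : IsGaloisObj A'.obj) (c : A' ⟶ A)
      (g : (temperedFrobenioidSmall R S).ratFnFunctor.obj (op A')), g ^ (N : ℕ) = pull (temperedFrobenioidSmall R S).ratFnFunctor c f :=
  (temperedFrobenioidSmall R S).rootLaw_of_baseRootLaw' _ (hPSmall R S)
    (fun _ _ hN => RealifiedDivisorMonoids.pow_injective_ΦR_gp_treeVocabWeak _ _ hN) (baseRootLaw_galois_temperedFrobenioidSmall R S) N A hA f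

/-! ## §2 The level-wise `μ_K`-saturation law at the small index -/

/-- A point of the coset re-presentation and its image in the covering have the same stabiliser behaviour: whatever fixes `s` fixes its image
under `reprIso`. [cite: MochizukiFrdII2008, Ex 1.3 (i) p.11] -/
theorem ρ_reprIso_hom_eq_of_ρ_eq (A : ConnectedPart (BTemp (Compat 3 thetaShear))) (s : (gset (repr A)).V) (g : Compat 3 thetaShear)
    (hgs : (gset (repr A)).ρ g s = s) : A.obj.obj.ρ g ((reprIso A).hom.hom.hom.hom s) = (reprIso A).hom.hom.hom.hom s := by
  rw [← BTempConnected.hom_ρ (reprIso A).hom.hom g s]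
  exact congrArg _ hgs

/-- **THE LEVEL-WISE `μ_K`-SATURATION LAW `hsat` HOLDS at the small-index fourth model** (abc-iut-w6-d037's binder, verbatim): for `K ∣ N_m`, every
object over a covering of level `≥ m` all of whose stabilisers have trivial index-`m` character coordinate is `μ_K`-saturated — abc-iut-L2-d2's
MU-TORSION (M3) at the fixed value `ζ_{N_m}` READ ON THE COSET RE-PRESENTATION `repr(A^bs)` (same level, `lvlC_repr`; stabilisers transported along
`reprIso`), fed to abc-iut-w6-d037's `isMuSaturated_of_bZero_generator`. [cite: MochizukiEtTh2009, Def 4.1 (iv) p.313 (PDF p.87)] -/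
theorem levelSaturation_small (K : ℕ+) (m : ℕ) (A : (temperedFrobenioidSmall R S).category) (hK : (K : ℕ) ∣ (N m : ℕ))
    (hm : m ≤ lvlC 3 thetaShear A.base)
    (hχ : ∀ (s : A.base.obj.obj.V) (g : Compat 3 thetaShear), A.base.obj.obj.ρ g s = s → (g : Grp 3 thetaShear).right.1 m = 1) :
    (temperedFrobenioidSmall R S).IsMuSaturated A K := by
  have hS := isConnectedGSet_gset (repr A.base)
  obtain ⟨s₀⟩ := hS.1
  have hm' : m ≤ lvlC 3 thetaShear (repr A.base) := by rw [lvlC_repr]; exact hm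
  -- (M3) at the fixed value `ζ_{N_m}` on the `Compat₃′`-set of the coset re-presentation
  obtain ⟨u, hdiv, hord, hgen⟩ := exists_units_generator_of_fixed (lvlC 3 thetaShear (repr A.base)) hS s₀
    ⟨zeta (TateTowerKummerTwist.MuN (lvlC 3 thetaShear (repr A.base)))
      (Multiplicative.ofAdd ((((N (lvlC 3 thetaShear (repr A.base)) : ℕ+) : ℕ) / ((N m : ℕ+) : ℕ) : ℕ) :
        ZMod (N (lvlC 3 thetaShear (repr A.base))))), rfl⟩ rfl
    (fun g hg => actFn_zetaImage_eq_of_right_eq_one hm' g (hχ _ g (ρ_reprIso_hom_eq_of_ρ_eq A.base s₀ g hg))) K.pos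
    (by
      change (K : ℕ) ∣ orderOf (Multiplicative.ofAdd _)
      rw [orderOf_zetaImage hm']
      exact hK)
  -- `B₀^Λ(A^bs)` of the small-index data IS `B₀(repr A^bs)`; read `div₀ u = 1` there
  have hdiv' : dmSmall.div₀ ((temperedFrobenioidSmall R S).baseOp (op A.base))
      (u : ↥((towerC₃sf.act (lvlC 3 thetaShear (repr A.base))).bZero (gset (repr A.base)))) = 1 := hdiv
  refine (temperedFrobenioidSmall R S).isMuSaturated_of_bZero_generator A (isDivisorial_small R S A.base) K u ?_ hord
    (fun b _ hb => hgen b hb)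
  rw [RealifiedDivisorMonoids.ofRlfZWeak_divΛ_apply]
  change EtaleTheta.gpMap _ (dmSmall.div₀ ((temperedFrobenioidSmall R S).baseOp (op A.base))
    (u : ↥((towerC₃sf.act (lvlC 3 thetaShear (repr A.base))).bZero (gset (repr A.base))))) = 1
  rw [hdiv']
  exact map_one _

/-- `hsat` in the producer-chosen-threshold form (`m := K`, `K ∣ (K+1)! = N_K`). [cite: MochizukiEtTh2009, Def 4.1 (iv) p.313 (PDF p.87)] -/
theorem levelSaturation_small' (K : ℕ+) : ∃ m : ℕ, ∀ A : (temperedFrobenioidSmall R S).category, m ≤ lvlC 3 thetaShear A.base →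
    (∀ (s : A.base.obj.obj.V) (g : Compat 3 thetaShear), A.base.obj.obj.ρ g s = s → (g : Grp 3 thetaShear).right.1 m = 1) →
      (temperedFrobenioidSmall R S).IsMuSaturated A K :=
  ⟨K, fun A hm hχ => levelSaturation_small R S K K A (Nat.dvd_factorial K.pos (Nat.le_succ _)) hm hχ⟩

/-! ## §3 The refinement law `hE` and the knit: [EtTh] Prop. 4.2 (iii) AS TYPED at the small-index §4 settings -/

/-- **`hE` ([FrdII] Rmk. 2.2.1, trivial `(N,H)`-slot) at the small index**: every Frobenius-trivial object with Galois base has a `μ_K`-saturated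
Galois-based pull-back refinement — abc-iut-w6-d037's deep Galois covering with `χ_K`-trivial stabilisers (over the SHARED base `B^temp(Compat₃′)⁰`,
verbatim), the pull-back morphism `(1, b, 0, 1)`, and `levelSaturation_small`. [cite: MochizukiEtTh2009, Prop 4.2 (iii) p.316 (PDF p.90)] -/
theorem refinementLaw_small :
    ∀ (K : ℕ+) (A' : (temperedFrobenioidSmall R S).category),
      PreFrobenioid.IsFrobeniusTrivial (temperedFrobenioidSmall R S).toElem A' → IsGaloisObj A'.base.obj →
      ∃ (A'' : (temperedFrobenioidSmall R S).category) (ψ : A'' ⟶ A'),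
        PreFrobenioid.IsPullbackMorphism (temperedFrobenioidSmall R S).toElem ψ ∧ IsGaloisObj A''.base.obj ∧
        (temperedFrobenioidSmall R S).IsMuSaturated A'' K ∧ True := by
  intro K A' _ _
  obtain ⟨Y', hY', b, hm, hχ⟩ := exists_galoisCover_level_charTrivial A'.base K
  obtain ⟨W, δ, hW, hδ⟩ := (temperedFrobenioidSmall R S).exists_isPullbackMorphism_over_baseHom
    (hypotheses_temperedFrobenioidSmall R S).isDivisorial A' b
  subst hW
  exact ⟨W, δ, hδ, hY', levelSaturation_small R S K K W (Nat.dvd_factorial K.pos (Nat.le_succ _)) hm hχ, trivial⟩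

section Setting

variable {K : Type} [Field K] (X : TemperedArithmeticGroup.{0} K) (φ : X.Pi →ₜ* Compat 3 thetaShear)
  (hφ : Function.Surjective φ)

/-- **[EtTh] Prop. 4.2 (iii) AS TYPED — POSITIVE at the SMALL-INDEX fourth model, `K : Type 0`**: for every tempered arithmetic group `X` over a
Type-0 field, every continuous SURJECTION `φ : Π^tp_X ↠ Compat₃′` (design-only socket) and every Frobenius-trivial Galois-based anchor `A_⊙`, the §4
setting `mkOfQuotientTemperoid X isTempered_compat₃′ φ hφ (temperedFrobenioidSmall R S) …` (trivial `(N,H)`-slot) satisfies «every fraction-pair over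
`A_⊙` has an `N`-th root for every `N ≥ 1`» — every law a THEOREM here (`Φ` divisorial, hDSpull, hR, hE, hS). [cite: MochizukiEtTh2009, Prop 4.2 (iii) p.314 (PDF p.88)] -/
theorem prop42_iii_mkOfQuotientTemperoid_small (A₀ : (temperedFrobenioidSmall R S).category)
    (hA₀ : PreFrobenioid.IsFrobeniusTrivial (temperedFrobenioidSmall R S).toElem A₀) (hA₀' : IsGaloisObj A₀.base.obj) :
    (BiKummerSetting.mkOfQuotientTemperoid X isTempered_compat₃' φ hφ (temperedFrobenioidSmall R S) rfl (hPSmall R S)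
        (fun _ _ _ => True) A₀ hA₀ hA₀').Prop42_iii
      (fun {_ _} ψ x => (temperedFrobenioidSmall R S).pullFracModel ψ x) :=
  BiKummerSetting.Prop42Sub.prop42_iii_mkOfModelCanonical_of_laws X (temperedFrobenioidSmall R S) rfl (hPSmall R S) _ _ _ _ A₀ hA₀ hA₀'
    (hypotheses_temperedFrobenioidSmall R S).isDivisorial
    (fun e _ _ hab y hya hyb => coprimePullLaw_small R S e hab y hya hyb)
    (rootLaw_galois_small R S) (refinementLaw_small R S)
    (BiKummerSetting.mkOfQuotientTemperoid_galoisSurj_natural X isTempered_compat₃' φ hφ (temperedFrobenioidSmall R S) rfl (hPSmall R S)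
      (fun _ _ _ => True) A₀ hA₀ hA₀')

/-- **Prop. 4.2 (iii) at gen 9's `settingSmall R S X φ hφ ⊤ M`** (anchor `(Compat₃′/M, 0)`). [cite: MochizukiEtTh2009, Prop 4.2 (iii) p.314 (PDF p.88)] -/
theorem prop42_iii_settingSmall (Mₒ : OpenNormalSubgroup (Compat 3 thetaShear)) :
    (settingSmall R S X φ hφ (fun _ _ _ => True) Mₒ).Prop42_iii (fun {_ _} ψ x => (temperedFrobenioidSmall R S).pullFracModel ψ x) :=
  prop42_iii_mkOfQuotientTemperoid_small R S X φ hφ _ _ _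

/-- **Prop. 4.2 (iii) at the `Ÿ`-choice setting `settingSmallYdd R S X φ hφ ⊤ T ιX`** (anchor `(Compat₃′/φ(ιX(Π^tp_Ÿ)), 0)`): abc-iut-L2-d2's fraction
pairs of `Θ̈` at the `Ÿ`-anchor acquire `N`-th roots for every `N ≥ 1` — D5's roots as THEOREMS at the carrier of record.
[cite: MochizukiEtTh2009, Prop 4.2 (iii) p.314 (PDF p.88)] -/
theorem prop42_iii_settingSmallYdd {Nθ : ℕ+} (T : ThetaEnvData.{0} Nθ) (ιX : T.PiX ≃ₜ* X.Pi) :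
    (settingSmallYdd R S X φ hφ (fun _ _ _ => True) T ιX).Prop42_iii
      (fun {_ _} ψ x => (temperedFrobenioidSmall R S).pullFracModel ψ x) :=
  prop42_iii_mkOfQuotientTemperoid_small R S X φ hφ _ _ _

/-- **ROOTS AS THEOREMS at the carrier of record**: every fraction pair over the anchor of `settingSmallYdd` has an `N`-th root object, for every
`N ≥ 1` (the `NthRoot` datum of the §5 junction is INHABITED at the small index). [cite: MochizukiEtTh2009, Prop 4.2 (iii) p.314 (PDF p.88)] -/
theorem nonempty_nthRoot_settingSmallYdd {Nθ : ℕ+} (T : ThetaEnvData.{0} Nθ) (ιX : T.PiX ≃ₜ* X.Pi) (N : ℕ+)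
    (f : (settingSmallYdd R S X φ hφ (fun _ _ _ => True) T ιX).biratUnits (settingSmallYdd R S X φ hφ (fun _ _ _ => True) T ιX).Aodot)
    {B : (settingSmallYdd R S X φ hφ (fun _ _ _ => True) T ιX).C}
    (P : (settingSmallYdd R S X φ hφ (fun _ _ _ => True) T ιX).FractionPair f B) :
    Nonempty ((settingSmallYdd R S X φ hφ (fun _ _ _ => True) T ιX).NthRoot f P N
      (fun ψ x => (temperedFrobenioidSmall R S).pullFracModel ψ x)) :=
  prop42_iii_settingSmallYdd R S X φ hφ T ιX f P N

end Setting

end ThetaTwistTowerSmallIndex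

end Literature.AnabelianGeometry.EtaleTheta

end
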